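import Mathlib

/-!
# Route RigidityForcesSymmetry — `GrenetFirstOrderRankRigid` (item stmt-ValiantsHypothesis-21029),
line `grenet_gauge`: stub `stub_linearRigid`, step 5 (block II, interior) — the linear algebra of an
overlap block of type II

For the crux line `Cruxes/GrenetFirstOrderRankRigid/Lines/grenet_gauge.lean` (blueprint
`Lines/grenet_gauge-stub_linearRigid-PROOF.md`, §5, block II; binder `hII` / stub `stub_blockII`).
Pure algebra, no Grenet machinery.  In the block `(A, k₀)` of type II the unknowns are `ρ C p`
(`C` a `k₀`-subset of `Aᶜ`, `p ∈ A ∪ C`) and `κ C p'` (`p' ∉ C`); the permanent terms only see the sums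
`ρ̄ p = Σ_C ρ C p`, `κ̄ p' = Σ_C κ C p'`.  The designs give equations of three shapes:

* (E1) `ρ C p + κ C p' = ρ̄ p + κ̄ p'` for `p, p' ∈ A` with `p ≠ p'` (or `p = p'` when `|A| = 1`) — the
  pure permutation points (doubled `A`-cells);
* (E2) `ρ C f + κ C α = ρ̄ α' + κ̄ α` for `f ∈ C`, `α ∈ A` and SOME `α' ∈ A` (`α' ≠ α` unless `|A| = 1`);
* (E3) `ρ C α + κ C g = ρ̄ α + κ̄ α''` for `α ∈ A`, `g ∉ A ∪ C` and SOME `α'' ∈ A` (`α'' ≠ α` unless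
  `|A| = 1`) — the permutation points with one extra cell.

`blockII_algebra`: if the number `N` of blocks `C` satisfies `N - 1 ≠ 0` in the (domain) `K` — in the
interior `N ≥ 2`, so this holds in characteristic zero — and every `C` is nonempty with `A ∪ C ≠ univ`,
then `ρ C p + κ C p' = 0` for all `p ∈ A ∪ C`, `p' ∉ C`: summing (E1) over `C` gives
`(N - 1)(ρ̄ p + κ̄ p') = 0`, whence (E1)–(E3) have vanishing right-hand sides, and the remaining pairs
(`(f, g)` and the diagonal `(α, α)`) are three-term combinations of those.

No new definitions.  VP ≠ VNP is not moved by this file.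
-/

open Finset

namespace Summit.ValiantsHypothesis.Theorems.RigidityForcesSymmetry.GrenetGauge

/-- **The linear algebra of a type-II block** (see the module docstring). [folklore] -/
theorem blockII_algebra {K : Type*} [CommRing K] [IsDomain K] {n : ℕ}
    (𝒞 : Finset (Finset (Fin n))) (A : Finset (Fin n)) (ρ κ : Finset (Fin n) → Fin n → K)
    (hN : ((𝒞.card : K) - 1) ≠ 0) (hA : 0 < A.card)
    (hCne : ∀ C ∈ 𝒞, C.Nonempty) (hG : ∀ C ∈ 𝒞, ∃ g, g ∉ A ∪ C)
    (hE1 : ∀ C ∈ 𝒞, ∀ p ∈ A, ∀ p' ∈ A, (p ≠ p' ∨ A.card = 1) →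
      ρ C p + κ C p' = ∑ C' ∈ 𝒞, ρ C' p + ∑ C' ∈ 𝒞, κ C' p')
    (hE2 : ∀ C ∈ 𝒞, ∀ f ∈ C, ∀ α ∈ A, ∃ α' ∈ A, (α' ≠ α ∨ A.card = 1) ∧
      ρ C f + κ C α = ∑ C' ∈ 𝒞, ρ C' α' + ∑ C' ∈ 𝒞, κ C' α)
    (hE3 : ∀ C ∈ 𝒞, ∀ α ∈ A, ∀ g, g ∉ A ∪ C → ∃ α'' ∈ A, (α ≠ α'' ∨ A.card = 1) ∧
      ρ C α + κ C g = ∑ C' ∈ 𝒞, ρ C' α + ∑ C' ∈ 𝒞, κ C' α'') :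
    ∀ C ∈ 𝒞, ∀ p ∈ A ∪ C, ∀ p', p' ∉ C → ρ C p + κ C p' = 0 := by
  classical
  -- Step 1: the sums vanish on admissible pairs of `A`
  have hS1 : ∀ p ∈ A, ∀ p' ∈ A, (p ≠ p' ∨ A.card = 1) →
      ∑ C' ∈ 𝒞, ρ C' p + ∑ C' ∈ 𝒞, κ C' p' = 0 := by
    intro p hp p' hp' hpp
    have hsum : ∑ C ∈ 𝒞, (ρ C p + κ C p') = ∑ C ∈ 𝒞, (∑ C' ∈ 𝒞, ρ C' p + ∑ C' ∈ 𝒞, κ C' p') :=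
      Finset.sum_congr rfl fun C hC => hE1 C hC p hp p' hp' hpp
    rw [Finset.sum_add_distrib, Finset.sum_const, nsmul_eq_mul] at hsum
    have h2 : ((𝒞.card : K) - 1) * (∑ C' ∈ 𝒞, ρ C' p + ∑ C' ∈ 𝒞, κ C' p') = 0 := by
      rw [sub_mul, one_mul, ← hsum, sub_self]
    exact (mul_eq_zero.mp h2).resolve_left hN
  -- Step 1': (E1) with vanishing right-hand side
  have hE1' : ∀ C ∈ 𝒞, ∀ p ∈ A, ∀ p' ∈ A, (p ≠ p' ∨ A.card = 1) → ρ C p + κ C p' = 0 := by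
    intro C hC p hp p' hp' hpp
    rw [hE1 C hC p hp p' hp' hpp, hS1 p hp p' hp' hpp]
  -- Step 2: (E2), (E3) with vanishing right-hand sides
  have hE2' : ∀ C ∈ 𝒞, ∀ f ∈ C, ∀ α ∈ A, ρ C f + κ C α = 0 := by
    intro C hC f hf α hα
    obtain ⟨α', hα', hne, h⟩ := hE2 C hC f hf α hα
    rw [h, hS1 α' hα' α hα hne]
  have hE3' : ∀ C ∈ 𝒞, ∀ α ∈ A, ∀ g, g ∉ A ∪ C → ρ C α + κ C g = 0 := by
    intro C hC α hα g hg
    obtain ⟨α'', hα'', hne, h⟩ := hE3 C hC α hα g hg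
    rw [h, hS1 α hα α'' hα'' hne]
  -- Step 3: the pairs `(f, g)`
  have hfg : ∀ C ∈ 𝒞, ∀ f ∈ C, ∀ g, g ∉ A ∪ C → ρ C f + κ C g = 0 := by
    intro C hC f hf g hg
    obtain ⟨α, hα⟩ := Finset.card_pos.mp hA
    by_cases ha : A.card = 1
    · have h1 := hE2' C hC f hf α hα
      have h2 := hE3' C hC α hα g hg
      have h3 := hE1' C hC α hα α hα (Or.inr ha)
      linear_combination h1 + h2 - h3
    · -- two distinct elements of `A`
      have hcard : 1 < A.card := by omega
      obtain ⟨β, hβ, hβα⟩ : ∃ β ∈ A, β ≠ α := by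
        obtain ⟨x, hx, y, hy, hxy⟩ := Finset.one_lt_card.mp hcard
        by_cases hxa : x = α
        · exact ⟨y, hy, fun h => hxy (hxa.trans h.symm)⟩
        · exact ⟨x, hx, hxa⟩
      have h1 := hE2' C hC f hf α hα
      have h2 := hE3' C hC β hβ g hg
      have h3 := hE1' C hC β hβ α hα (Or.inl hβα)
      linear_combination h1 + h2 - h3
  -- conclusion
  intro C hC p hp p' hp'
  rcases Finset.mem_union.mp hp with hpA | hpC
  · by_cases hp'A : p' ∈ A
    · by_cases hpp : p ≠ p' ∨ A.card = 1
      · exact hE1' C hC p hpA p' hp'A hpp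
      · -- the diagonal `p = p'` with `|A| ≥ 2`: through a row of `C` and a row outside `A ∪ C`
        rw [not_or] at hpp
        have hpeq : p = p' := not_not.mp hpp.1
        subst hpeq
        obtain ⟨f, hf⟩ := hCne C hC
        obtain ⟨g, hg⟩ := hG C hC
        have h1 := hE3' C hC p hpA g hg
        have h2 := hE2' C hC f hf p hpA
        have h3 := hfg C hC f hf g hg
        linear_combination h1 + h2 - h3
    · have hg : p' ∉ A ∪ C := fun h => (Finset.mem_union.mp h).elim hp'A hp'
      exact hE3' C hC p hpA p' hg
  · by_cases hp'A : p' ∈ A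
    · exact hE2' C hC p hpC p' hp'A
    · exact hfg C hC p hpC p' fun h => (Finset.mem_union.mp h).elim hp'A hp'
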